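import Literature.NumberTheory.Automorphic.UnitaryThreePHTowerPackage           -- ★ tower top: defs `toQuotPow` ∕ `flickerPHRho`, every CITE of the (C2) census §1
import Literature.NumberTheory.Automorphic.UnitaryThreeBorelNormalFormUnramified  -- (i) LH5-p05: `exists_coe_eq_borel_of_mem_flickerPH'` ∕ `exists_mem_flickerPH_coe_eq'` (datum-free)
import HarnessLib

/-!
# The `ρ_m`-facts of Flicker's Prop. 8 tower over an UNRAMIFIED local conjugation datum (every residue characteristic)

(Flicker, *Elementary proof of the fundamental lemma for a unitary group* (1998), Prop. 8 pp. 84–85)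

LAYER C block (C2), file C2-A of the (C2) census `CENSUS-C2-PHTower.v1.md` (565a49c0, dealer LH4-plan (g7) WORD #20): the six
`hd : LocalConjDatum σ ϖ`-keyed heads of ★ `UnitaryThreePHTowerRho` ∕ ★ `UnitaryThreePHTowerPackage` that involve NO level element,
re-stated over `hd : UnramifiedLocalConjDatum σ ϖ` (+ the characteristic token `(h2 : (2 : K) ≠ 0)` exactly where the Borel normal form of
`P_H` is read) with BYTE-IDENTICAL conclusions:

* `flickerPHRho_eq_iff_of_unram` — (H1) the fibres of `ρ_m` on `P_H` are the `N₀(ϖ^m)`-cosets;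
* `isUnit_flickerPHRho_fst_of_unram`, `quotientMap_flickerPHRho_snd_of_unram` — (H3) `ρ_m(p) ∈ units × anti-fixed`;
* `exists_mem_flickerPH_flickerPHRho_eq_of_unram` — (H3) surjectivity onto `units × anti-fixed`; here is the ONE change of proof: ★ lifts an
  anti-fixed CLASS `b̄` to the exactly anti-fixed element `(b − σb)∕2`; we lift it 2-freely to `x := b − τ·(b + σb)` with `τ + στ = 1`, `|τ| ≤ 1`
  (`UnramifiedLocalConjDatum.trace`): `x + σx = (b + σb)(1 − τ − στ) = 0` and `x − b = −τ(b + σb) ∈ 𝓂^m`;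
* `index_flickerPH0_subgroupOf_flickerPH_of_unram` — `[P_H : N₀(ϖ^m)] = #(𝒪⧸𝓂^m)ˣ · #{anti-fixed classes}`;
* `natCard_antifixed_eq_of_unram` — `#{anti-fixed classes mod 𝓂^m} = q^m` (★ `natCard_antifixed_quotient_pow` is 2-free).

The definitions `toQuotPow`, `flickerPHRho` and all datum-free lemmas (`flickerPHRho_of_coe_eq`, `toQuotPow_of_le`, `toQuotPow_eq_toQuotPow_iff`,
`coe_inv_mul_of_coe_eq`, `mem_maximalIdeal_pow_iff_v_le`, `maximalIdeal_pow_le_comap_codRestrict`, `mem_flickerPH0_iff_of_coe_eq`, `v_eq_one_of_isUnit_mk`)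
are ★'s, IMPORTED UNCHANGED (same `ρ_m`: second coordinate = the skew parameter `x` of `p(u,x,w)`).  Bodies are ★'s verbatim with
`exists_coe_eq_borel_of_mem_flickerPH σ hJ hd hc ↦ exists_coe_eq_borel_of_mem_flickerPH' σ hJ hd.σσ hd.vσ h2 hc` (LH5-p05's 2-free twin).
THEOREMS ONLY: no definition, no instance, no notation, no named fact, no `sorry`.  Cell `pub/hodgecm-mathlib`, squad LH4, seat LH4-p01 (g6);
count-neutral ((D-UNR) PRINT).

## References
* [Flicker1998UnitaryFL] Y. Z. Flicker, *Elementary proof of the fundamental lemma for a unitary group*, Canad. J. Math. 50 (1998), Prop. 8 pp. 84–85.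
-/

open scoped MatrixGroups WithZero Valued
open Matrix IsLocalRing

namespace Literature.NumberTheory.Automorphic

namespace UnitaryGroup

open Literature.NumberTheory.Automorphic.HermitianLattice (unitaryInt mem_unitaryInt_iff UnramifiedLocalConjDatum)

section HOne

variable {K : Type*} [Field K] [Valued K ℤᵐ⁰] {ϖ : K} (σ : K →+* K) {J : Matrix (Fin 3) (Fin 3) K} (hJ : J = (StdForm.antidiagonal 3).over K)

include hJ in
/-- **(H1) THE FIBRES OF `ρ_m` ARE THE `N₀(ϖ^m)`-COSETS, unramified datum** (twin of ★ `flickerPHRho_eq_iff`; `(2 : K) ≠ 0` is a characteristic token only):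
for `p, p′ ∈ P_H`, `ρ_m p = ρ_m p′ ↔ p⁻¹ p′ ∈ N₀(ϖ^m)`. [cite: Flicker1998UnitaryFL, Prop. 8 pp. 84–85] -/
theorem flickerPHRho_eq_iff_of_unram (hd : UnramifiedLocalConjDatum σ ϖ) (h2 : (2 : K) ≠ 0) {c : ↥(unitaryGroupOfForm σ J)}
    (hc : ((c : GL (Fin 3) K) : Matrix (Fin 3) (Fin 3) K) = !![1, 0, 0; 0, -1, 0; 0, 0, 1]) (m : ℕ)
    {p p' : ↥(unitaryGroupOfForm σ J)} (hp : p ∈ flickerPH σ J c) (hp' : p' ∈ flickerPH σ J c) :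
    flickerPHRho σ m p = flickerPHRho σ m p' ↔ p⁻¹ * p' ∈ flickerPH0 σ J c (ϖ ^ m) := by
  have hσσ : ∀ a, σ (σ a) = a := hd.σσ
  obtain ⟨u, x, w, hcoe, hu, hx, -, hw, hσw⟩ := exists_coe_eq_borel_of_mem_flickerPH' σ hJ hd.σσ hd.vσ h2 hc hp
  obtain ⟨u', x', w', hcoe', hu', hx', -, hw', hσw'⟩ := exists_coe_eq_borel_of_mem_flickerPH' σ hJ hd.σσ hd.vσ h2 hc hp'
  have hu0 : u ≠ 0 := fun h => by rw [h, map_zero] at hu; exact zero_ne_one hu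
  have hw0 : w ≠ 0 := fun h => by rw [h, map_zero] at hw; exact zero_ne_one hw
  have hu0' : u' ≠ 0 := fun h => by rw [h, map_zero] at hu'; exact zero_ne_one hu'
  have hw0' : w' ≠ 0 := fun h => by rw [h, map_zero] at hw'; exact zero_ne_one hw'
  have hσu0 : σ u ≠ 0 := fun h => hu0 (by rw [← hσσ u, h, map_zero])
  have hσu0' : σ u' ≠ 0 := fun h => hu0' (by rw [← hσσ u', h, map_zero])
  have vσu : Valued.v (σ u) = 1 := by rw [hd.vσ, hu]
  have vσu' : Valued.v (σ u') = 1 := by rw [hd.vσ, hu']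
  have va : Valued.v (u * w⁻¹) ≤ 1 := by rw [map_mul, map_inv₀, hu, hw, inv_one, one_mul]
  have vb : Valued.v (u' * w'⁻¹) ≤ 1 := by rw [map_mul, map_inv₀, hu', hw', inv_one, one_mul]
  rw [flickerPHRho_of_coe_eq σ m hcoe hu0, flickerPHRho_of_coe_eq σ m hcoe' hu0', Prod.mk.injEq,
    toQuotPow_eq_toQuotPow_iff hd.vϖ m va vb, toQuotPow_eq_toQuotPow_iff hd.vϖ m hx hx']
  have hmem : p⁻¹ * p' ∈ flickerPH σ J c := Subgroup.mul_mem _ (Subgroup.inv_mem _ hp) hp'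
  have hcoe'' := coe_inv_mul_of_coe_eq σ hσσ hcoe hcoe' hu0 hw0 hu0'
  have hu'' : Valued.v (u' / u) = 1 := by rw [map_div₀, hu, hu', div_one]
  have hw'' : Valued.v (w' / w) = 1 := by rw [map_div₀, hw, hw', div_one]
  have hσw'' : σ (w' / w) * (w' / w) = 1 := by
    rw [map_div₀, div_mul_div_comm, hσw', hσw, div_one]
  rw [mem_flickerPH0_iff_of_coe_eq σ hJ hd.vσ hσσ hmem hcoe'' hu'' hw'' hσw'' (ϖ ^ m)]
  -- the two valuation identities
  set D : K := u * w⁻¹ - u' * w'⁻¹ with hD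
  have e1 : Valued.v (u' / u * (w' / w)⁻¹ - 1) = Valued.v D := by
    have : u' / u * (w' / w)⁻¹ - 1 = -D * (w / u) := by rw [hD]; field_simp; ring
    rw [this, map_mul, Valuation.map_neg, map_div₀, hu, hw, div_one, mul_one]
  set r : K := x * (u * σ u) / (u' * σ u') with hr
  have e2 : Valued.v (x' - r) = Valued.v ((x' - x) - x * ((u * σ u) / (u' * σ u') - 1)) := by
    congr 1; rw [hr]; ring
  -- `N(u) ≡ N(u′)` modulo `D`
  have e3 : Valued.v ((u * σ u) / (u' * σ u') - 1) ≤ Valued.v D := by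
    have hN : u * σ u - u' * σ u' = (D * w * w') * σ (u * w') + (u' * w) * σ (D * w * w') := by
      have hsw : σ w = w⁻¹ := by rw [← mul_eq_one_iff_eq_inv₀ hw0]; exact hσw
      have hsw' : σ w' = w'⁻¹ := by rw [← mul_eq_one_iff_eq_inv₀ hw0']; exact hσw'
      rw [hD]; simp only [map_mul, map_sub, map_inv₀, hsw, hsw']; field_simp; ring
    have : (u * σ u) / (u' * σ u') - 1 = (u * σ u - u' * σ u') / (u' * σ u') := by field_simp
    rw [this, map_div₀, map_mul, hu', vσu', mul_one, div_one, hN]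
    refine Valuation.map_add_le _ ?_ ?_
    · simp only [map_mul, hd.vσ, hu, hw, hw', mul_one, le_refl]
    · simp only [map_mul, hd.vσ, hu', hw, hw', mul_one, one_mul, le_refl]
  constructor
  · rintro ⟨h1, h2'⟩
    refine ⟨by rwa [e1], ?_⟩
    rw [e2]
    refine Valuation.map_sub_le _ (by rw [← Valuation.map_neg, neg_sub]; exact h2') ?_
    rw [map_mul]; exact (mul_le_mul' hx (e3.trans h1)).trans (by rw [one_mul])
  · rintro ⟨h1, h2'⟩
    rw [e1] at h1
    refine ⟨h1, ?_⟩
    have : x - x' = -((x' - r) + x * ((u * σ u) / (u' * σ u') - 1)) := by rw [hr]; ring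
    rw [this, Valuation.map_neg]
    refine Valuation.map_add_le _ h2' ?_
    rw [map_mul]; exact (mul_le_mul' hx (e3.trans h1)).trans (by rw [one_mul])

end HOne

section HThree

variable {K : Type*} [Field K] [Valued K ℤᵐ⁰] {ϖ : K} (σ : K →+* K) {J : Matrix (Fin 3) (Fin 3) K} (hJ : J = (StdForm.antidiagonal 3).over K)

include hJ in
/-- **(H3, first coordinate) `ρ_m(p)₁` is a unit** of `𝒪⧸𝓂^m`, unramified datum (twin of ★ `isUnit_flickerPHRho_fst`). [cite: Flicker1998UnitaryFL, Prop. 8 pp. 84–85] -/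
theorem isUnit_flickerPHRho_fst_of_unram (hd : UnramifiedLocalConjDatum σ ϖ) (h2 : (2 : K) ≠ 0) {c : ↥(unitaryGroupOfForm σ J)}
    (hc : ((c : GL (Fin 3) K) : Matrix (Fin 3) (Fin 3) K) = !![1, 0, 0; 0, -1, 0; 0, 0, 1]) (m : ℕ)
    {p : ↥(unitaryGroupOfForm σ J)} (hp : p ∈ flickerPH σ J c) : IsUnit (flickerPHRho σ m p).1 := by
  obtain ⟨u, x, w, hcoe, hu, -, -, hw, -⟩ := exists_coe_eq_borel_of_mem_flickerPH' σ hJ hd.σσ hd.vσ h2 hc hp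
  have hu0 : u ≠ 0 := fun h => by rw [h, map_zero] at hu; exact zero_ne_one hu
  have va : Valued.v (u * w⁻¹) = 1 := by rw [map_mul, map_inv₀, hu, hw, inv_one, one_mul]
  rw [flickerPHRho_of_coe_eq σ m hcoe hu0, toQuotPow_of_le m va.le]
  refine IsUnit.map _ ?_
  rw [(Valuation.integer.integers (Valued.v (R := K))).isUnit_iff_valuation_eq_one]
  exact va

include hJ in
/-- **(H3, second coordinate) `ρ_m(p)₂` is ANTI-FIXED** under the reduction of `σ` to `𝒪⧸𝓂^m`, unramified datum (twin of ★ `quotientMap_flickerPHRho_snd`).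
[cite: Flicker1998UnitaryFL, Prop. 8 pp. 84–85] -/
theorem quotientMap_flickerPHRho_snd_of_unram (hd : UnramifiedLocalConjDatum σ ϖ) (h2 : (2 : K) ≠ 0)
    (hσO : ∀ y : 𝒪[K], (σ.comp 𝒪[K].subtype) y ∈ 𝒪[K])
    {c : ↥(unitaryGroupOfForm σ J)} (hc : ((c : GL (Fin 3) K) : Matrix (Fin 3) (Fin 3) K) = !![1, 0, 0; 0, -1, 0; 0, 0, 1]) (m : ℕ)
    {p : ↥(unitaryGroupOfForm σ J)} (hp : p ∈ flickerPH σ J c) :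
    Ideal.quotientMap (𝓂[K] ^ m) ((σ.comp 𝒪[K].subtype).codRestrict 𝒪[K] hσO)
        (maximalIdeal_pow_le_comap_codRestrict σ hd.vϖ hd.vσ hσO m) (flickerPHRho σ m p).2 = -(flickerPHRho σ m p).2 := by
  obtain ⟨u, x, w, hcoe, hu, hx, hσx, -, -⟩ := exists_coe_eq_borel_of_mem_flickerPH' σ hJ hd.σσ hd.vσ h2 hc hp
  have hu0 : u ≠ 0 := fun h => by rw [h, map_zero] at hu; exact zero_ne_one hu
  rw [flickerPHRho_of_coe_eq σ m hcoe hu0, toQuotPow_of_le m hx, Ideal.quotientMap_mk, ← map_neg]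
  congr 1
  apply Subtype.ext
  change σ x = -x
  exact hσx

include hJ in
/-- **(H3, surjectivity) every pair `(unit, anti-fixed class)` is a value of `ρ_m` on `P_H`, at EVERY residue characteristic** (twin of ★
`exists_mem_flickerPH_flickerPHRho_eq`): given `a ∈ 𝒪^×` and `b ∈ 𝒪` with `σ̄ b̄ = −b̄ (mod 𝓂^m)`, the element `p(a, x, 1) ∈ P_H` with the 2-FREE lift
`x := b − τ·(b + σb)`, `τ + στ = 1`, `|τ| ≤ 1` (`UnramifiedLocalConjDatum.trace`) — exactly anti-fixed (`x + σx = (b + σb)(1 − τ − στ) = 0`) and `≡ b`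
(`x − b = −τ(b + σb)`) — has `ρ_m = (ā, b̄)`.  ★ used `x := (b − σb)∕2`. [cite: Flicker1998UnitaryFL, Prop. 8 pp. 84–85] -/
theorem exists_mem_flickerPH_flickerPHRho_eq_of_unram (hd : UnramifiedLocalConjDatum σ ϖ) (h2 : (2 : K) ≠ 0)
    (hσO : ∀ y : 𝒪[K], (σ.comp 𝒪[K].subtype) y ∈ 𝒪[K])
    {c : ↥(unitaryGroupOfForm σ J)} (hc : ((c : GL (Fin 3) K) : Matrix (Fin 3) (Fin 3) K) = !![1, 0, 0; 0, -1, 0; 0, 0, 1]) (m : ℕ)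
    (a b : 𝒪[K]) (ha : Valued.v (a : K) = 1)
    (hb : Ideal.quotientMap (𝓂[K] ^ m) ((σ.comp 𝒪[K].subtype).codRestrict 𝒪[K] hσO)
        (maximalIdeal_pow_le_comap_codRestrict σ hd.vϖ hd.vσ hσO m) (Ideal.Quotient.mk (𝓂[K] ^ m) b) = -Ideal.Quotient.mk (𝓂[K] ^ m) b) :
    ∃ p : ↥(unitaryGroupOfForm σ J), p ∈ flickerPH σ J c ∧
      flickerPHRho σ m p = (Ideal.Quotient.mk (𝓂[K] ^ m) a, Ideal.Quotient.mk (𝓂[K] ^ m) b) := by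
  have hσσ : ∀ t, σ (σ t) = t := hd.σσ
  obtain ⟨τ, hτv, hτ⟩ := hd.trace
  -- the 2-free anti-fixed lift of the class of `b`
  set x : K := (b : K) - τ * ((b : K) + σ b) with hx_def
  have hστ : σ τ = 1 - τ := by linear_combination hτ
  have hσx : σ x = -x := by
    rw [hx_def, map_sub, map_mul, map_add, hσσ, hστ]; ring
  have hbσ : Valued.v ((b : K) + σ b) ≤ 1 := Valuation.map_add_le _ b.2 (by rw [hd.vσ]; exact b.2)
  have hx : Valued.v x ≤ 1 := by
    rw [hx_def]
    refine Valuation.map_sub_le _ b.2 ?_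
    rw [map_mul]; exact mul_le_one' hτv hbσ
  have ha0 : (a : K) ≠ 0 := fun h => by rw [h, map_zero] at ha; exact zero_ne_one ha
  obtain ⟨p, hp, hcoe⟩ := exists_mem_flickerPH_coe_eq' σ hJ hd.σσ hd.vσ h2 hc ha hx hσx
    (by rw [map_one] : Valued.v (1 : K) = 1) (by rw [map_one, mul_one])
  refine ⟨p, hp, ?_⟩
  rw [flickerPHRho_of_coe_eq σ m hcoe ha0, inv_one, mul_one, toQuotPow_of_le m a.2, toQuotPow_of_le m hx, Prod.mk.injEq]
  refine ⟨rfl, ?_⟩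
  -- `x ≡ b (mod 𝓂^m)`: `x − b = −τ(σb + b)` and `σ̄ b̄ = −b̄`
  rw [Ideal.quotientMap_mk, ← map_neg, Ideal.Quotient.eq] at hb
  rw [Ideal.Quotient.eq, mem_maximalIdeal_pow_iff_v_le hd.vϖ]
  have hb' := (mem_maximalIdeal_pow_iff_v_le hd.vϖ m _).1 hb
  change Valued.v (σ (b : K) - -(b : K)) ≤ _ at hb'
  change Valued.v (x - (b : K)) ≤ _
  have : x - (b : K) = -(τ * (σ (b : K) - -(b : K))) := by rw [hx_def]; ring
  rw [this, Valuation.map_neg, map_mul]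
  exact (mul_le_mul' hτv hb').trans_eq (one_mul _)

end HThree

section Package

variable {K : Type*} [Field K] [Valued K ℤᵐ⁰] {ϖ : K} (σ : K →+* K) {J : Matrix (Fin 3) (Fin 3) K} (hJ : J = (StdForm.antidiagonal 3).over K)

include hJ in
/-- **(H1) + (H3) packaged, unramified datum: `P_H ⧸ N₀(ϖ^m) ≃ (𝒪⧸𝓂^m)ˣ × {anti-fixed classes}`** through `ρ_m`, hence
`[P_H : N₀(ϖ^m)] = #(𝒪⧸𝓂^m)ˣ · #{β : σ̄β = −β}` (twin of ★ `index_flickerPH0_subgroupOf_flickerPH`; every residue characteristic).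
[cite: Flicker1998UnitaryFL, Prop. 8 pp. 84–85] -/
theorem index_flickerPH0_subgroupOf_flickerPH_of_unram (hd : UnramifiedLocalConjDatum σ ϖ) (h2 : (2 : K) ≠ 0)
    (hσO : ∀ z : 𝒪[K], (σ.comp 𝒪[K].subtype) z ∈ 𝒪[K]) (m : ℕ)
    {c : ↥(unitaryGroupOfForm σ J)} (hc : ((c : GL (Fin 3) K) : Matrix (Fin 3) (Fin 3) K) = !![1, 0, 0; 0, -1, 0; 0, 0, 1]) :
    ((flickerPH0 σ J c (ϖ ^ m)).subgroupOf (flickerPH σ J c)).index =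
      Nat.card (𝒪[K] ⧸ 𝓂[K] ^ m)ˣ *
        Nat.card {β : 𝒪[K] ⧸ 𝓂[K] ^ m //
          Ideal.quotientMap (𝓂[K] ^ m) ((σ.comp 𝒪[K].subtype).codRestrict 𝒪[K] hσO)
            (maximalIdeal_pow_le_comap_codRestrict σ hd.vϖ hd.vσ hσO m) β = -β} := by
  set σq := Ideal.quotientMap (𝓂[K] ^ m) ((σ.comp 𝒪[K].subtype).codRestrict 𝒪[K] hσO)
    (maximalIdeal_pow_le_comap_codRestrict σ hd.vϖ hd.vσ hσO m) with hσq
  set P := flickerPH σ J c with hPdef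
  set N := (flickerPH0 σ J c (ϖ ^ m)).subgroupOf P with hNdef
  let X := {q : (𝒪[K] ⧸ 𝓂[K] ^ m) × (𝒪[K] ⧸ 𝓂[K] ^ m) // IsUnit q.1 ∧ σq q.2 = -q.2}
  let ρX : ↥P → X := fun p => ⟨flickerPHRho σ m (p : ↥(unitaryGroupOfForm σ J)),
    isUnit_flickerPHRho_fst_of_unram σ hJ hd h2 hc m p.2, quotientMap_flickerPHRho_snd_of_unram σ hJ hd h2 hσO hc m p.2⟩
  have hwd : ∀ a b : ↥P, QuotientGroup.leftRel N a b → ρX a = ρX b := by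
    intro a b hab
    rw [QuotientGroup.leftRel_apply, hNdef, Subgroup.mem_subgroupOf, Subgroup.coe_mul, Subgroup.coe_inv] at hab
    apply Subtype.ext
    exact (flickerPHRho_eq_iff_of_unram σ hJ hd h2 hc m a.2 b.2).2 hab
  let ρQ : ↥P ⧸ N → X := Quotient.lift ρX hwd
  have hbij : Function.Bijective ρQ := by
    constructor
    · intro q₁ q₂ h
      induction q₁ using QuotientGroup.induction_on with | H a => ?_
      induction q₂ using QuotientGroup.induction_on with | H b => ?_
      apply Quotient.sound
      change QuotientGroup.leftRel N a b
      rw [QuotientGroup.leftRel_apply, hNdef, Subgroup.mem_subgroupOf, Subgroup.coe_mul, Subgroup.coe_inv]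
      exact (flickerPHRho_eq_iff_of_unram σ hJ hd h2 hc m a.2 b.2).1 (congrArg Subtype.val h)
    · rintro ⟨⟨α, β⟩, hα, hβ⟩
      obtain ⟨b, rfl⟩ := Ideal.Quotient.mk_surjective β
      -- a representative of valuation one for the unit class `α`
      obtain ⟨a, ha, rfl⟩ : ∃ a : 𝒪[K], Valued.v (a : K) = 1 ∧ Ideal.Quotient.mk (𝓂[K] ^ m) a = α := by
        rcases Nat.eq_zero_or_pos m with hm | hm
        · refine ⟨1, by rw [OneMemClass.coe_one, map_one], ?_⟩
          obtain ⟨a, rfl⟩ := Ideal.Quotient.mk_surjective α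
          rw [Ideal.Quotient.eq, hm, pow_zero, Ideal.one_eq_top]; exact Submodule.mem_top
        · obtain ⟨a, rfl⟩ := Ideal.Quotient.mk_surjective α
          exact ⟨a, v_eq_one_of_isUnit_mk hd.vϖ hm hα, rfl⟩
      obtain ⟨p, hp, hρ⟩ := exists_mem_flickerPH_flickerPHRho_eq_of_unram σ hJ hd h2 hσO hc m a b ha hβ
      refine ⟨QuotientGroup.mk ⟨p, hp⟩, ?_⟩
      apply Subtype.ext
      exact hρ
  rw [Subgroup.index, Nat.card_congr (Equiv.ofBijective ρQ hbij)]
  -- `#X = #units · #anti-fixed`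
  rw [← Nat.card_prod]
  refine Nat.card_congr
    { toFun := fun q => (q.2.1.unit, ⟨q.1.2, q.2.2⟩)
      invFun := fun y => ⟨(↑y.1, y.2.1), Units.isUnit _, y.2.2⟩
      left_inv := fun q => by ext <;> simp
      right_inv := fun y => by ext <;> simp }

variable [IsDiscreteValuationRing 𝒪[K]]

/-- **The anti-fixed class count at `R := 𝒪[K]`, `σ := σO`, unramified datum: `#{β ∈ 𝒪⧸𝓂^m : σ̄β = −β} = q^m`** (twin of ★ `natCard_antifixed_eq`;
★ `LocalFields.…natCard_antifixed_quotient_pow` multiplies the `σ̄`-fixed classes by the anti-symmetric unit `σa₀ − a₀` — no `|2| = 1`).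
[cite: Flicker1998UnitaryFL, Prop. 8 p. 85] -/
theorem natCard_antifixed_eq_of_unram (hd : UnramifiedLocalConjDatum σ ϖ) (hσO : ∀ z : 𝒪[K], (σ.comp 𝒪[K].subtype) z ∈ 𝒪[K])
    {q : ℕ} (hq : Nat.card (ResidueField 𝒪[K]) = q ^ 2)
    {a₀ : 𝒪[K]} (ha₀ : IsUnit (((σ.comp 𝒪[K].subtype).codRestrict 𝒪[K] hσO) a₀ - a₀)) (m : ℕ) :
    Nat.card {β : 𝒪[K] ⧸ 𝓂[K] ^ m //
        Ideal.quotientMap (𝓂[K] ^ m) ((σ.comp 𝒪[K].subtype).codRestrict 𝒪[K] hσO)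
          (maximalIdeal_pow_le_comap_codRestrict σ hd.vϖ hd.vσ hσO m) β = -β} = q ^ m := by
  have hσσ : ∀ z : 𝒪[K], ((σ.comp 𝒪[K].subtype).codRestrict 𝒪[K] hσO) (((σ.comp 𝒪[K].subtype).codRestrict 𝒪[K] hσO) z) = z :=
    fun z => Subtype.ext (hd.σσ (z : K))
  exact Literature.NumberTheory.LocalFields.UnramifiedQuadraticNorm.natCard_antifixed_quotient_pow _ hσσ ha₀ hq m

end Package

end UnitaryGroup

end Literature.NumberTheory.Automorphic
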